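import Mathlib.Topology.MetricSpace.HausdorffDimension
import Literature.Topology.FourManifolds.CircleSurgeryExistence
import Literature.Topology.FourManifolds.Knots
import HarnessLib

/-!
# Smooth maps of spheres `𝕊ᵏ → 𝕊ⁿ`, `k < n`, miss points (Hirsch, Ch. 3, §1, Prop. 1.2)

Topic `Literature/Topology/FourManifolds`; a brick for the 2-knot facts of `GluckTwist.lean` and
`FramedTubularNbhd.lean` (roadmap of the named fact `Literature.Topology.FourManifolds.TwoKnot.nonempty_normalFraming`,
`FramedTubularNbhd.lean`: the planned proof transports normal vectors along chords of `S⁴` from a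
base point `a` with `±a` off the 2-knot), the discharge of the named fact
`Literature.Topology.FourManifolds.SphereEmbedding.nonempty_complement` (`Knots.lean`), and more generally every argument that
stereographically projects a knot `S¹ ↪ S³` or a 2-knot `S² ↪ S⁴` into Euclidean space from a
point off its image.

Hirsch, *Differential Topology* (1976), Ch. 3, §1, Prop. 1.2: *if `dim M < dim N` and `f : M → N`
is `C¹` then `f(M)` is nowhere dense* (the trivial case of the Morse–Sard theorem). We prove the
consequence needed in the tree, for round spheres, through Mathlib's Hausdorff dimension
(`Mathlib.Topology.MetricSpace.HausdorffDimension`: `C¹` maps on convex sets do not raise `dimH`):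

* `Literature.Topology.FourManifolds.dimH_sphere_le`: `dimH 𝕊ⁿ ≤ n` (off a point, `𝕊ⁿ` is the image of the `n`-space `vᗮ` under
  the smooth inverse stereographic projection `stereoInvFunAux`);
* `Literature.Topology.FourManifolds.le_dimH_sphere_diff_singleton`: `n ≤ dimH (𝕊ⁿ ∖ {v})` (the stereographic projection
  `stereoToFun v`, smooth on the open half-space `⟪v, ·⟫ < 1`, maps it onto `vᗮ ≅ ℝⁿ`);
* `Literature.Topology.FourManifolds.dimH_range_coe_comp_le`: for a `C¹` map `f : 𝕊ᵏ → 𝕊ⁿ`, `dimH (ι ∘ f)(𝕊ᵏ) ≤ k` (radial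
  extension `ι ∘ f ∘ (y ↦ y/‖y‖)`, `C¹` on the `2(k+1)` convex open half-spaces `± yᵢ > 0`
  covering `𝕊ᵏ`; the tree's `Literature.Topology.FourManifolds.radialProjection`, `Literature.Topology.FourManifolds.contMDiffOn_radialProjection`);
* **`Literature.Topology.FourManifolds.exists_notMem_range_of_contMDiff`**: a `C¹` map `𝕊ᵏ → 𝕊ⁿ` with `k < n` is not
  surjective; it even misses a pair of antipodal points
  (`Literature.Topology.FourManifolds.exists_notMem_range_neg_notMem_range_of_contMDiff`); corollaries
  `Literature.Topology.FourManifolds.SphereEmbedding.exists_notMem_range` (any `Literature.SphereEmbedding k n`, `k < n`),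
  `Literature.Topology.FourManifolds.TwoKnot.exists_notMem_range`, `Literature.Topology.FourManifolds.TwoKnot.exists_notMem_range_neg_notMem_range`, and the
  **discharge** `Literature.Topology.FourManifolds.SphereEmbedding.nonempty_complement_holds` of the named fact
  `Literature.Topology.FourManifolds.SphereEmbedding.nonempty_complement` (`Knots.lean`).

Everything here is proved; no named facts.

## References

* M. W. Hirsch, *Differential Topology*, GTM 33, Springer (1976), Ch. 3, §1, Prop. 1.2 and
  Lemma 1.1. [HirschDT1976]
-/

open scoped Manifold ContDiff Topology RealInnerProductSpace ENNReal
open Set Function Metric Module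

noncomputable section

namespace Literature.Topology.FourManifolds

local notation "𝔼 " n:arg => EuclideanSpace ℝ (Fin n)
local notation "𝕊 " n:arg => (Metric.sphere (0 : EuclideanSpace ℝ (Fin (n + 1))) 1)

section DimH

variable {n : ℕ}

/-- The unit sphere of `ℝⁿ⁺¹`, minus a point, has Hausdorff dimension at least `n`: the
stereographic projection from that point is smooth on an open half-space containing the rest of
the sphere and maps it onto an `n`-dimensional space. [folklore] -/
theorem le_dimH_sphere_diff_singleton (v : 𝕊 n) :
    (n : ℝ≥0∞) ≤ dimH ((sphere (0 : 𝔼 (n+1)) 1) \ {(v : 𝔼 (n+1))}) := by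
  haveI := Fact.mk (@finrank_euclideanSpace_fin ℝ _ (n + 1))
  have hv : ‖(v : 𝔼 (n+1))‖ = 1 := norm_eq_of_mem_sphere v
  set W : Submodule ℝ (𝔼 (n+1)) := (ℝ ∙ (v : 𝔼 (n+1)))ᗮ
  have hW : finrank ℝ W = n := Submodule.finrank_orthogonal_span_singleton (ne_zero_of_mem_unit_sphere v)
  -- the open half-space `⟪v, y⟫ < 1`
  set C : Set (𝔼 (n+1)) := {y | innerSL ℝ (v : 𝔼 (n+1)) y < 1}
  have hC : Convex ℝ C := convex_halfSpace_lt (innerSL ℝ (v : 𝔼 (n+1))).isLinear 1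
  have hσ : ContDiffOn ℝ 1 (stereoToFun (v : 𝔼 (n+1))) C :=
    (contDiffOn_stereoToFun (n := 1)).mono fun y (hy : _ < _) => hy.ne
  have hsub : (sphere (0 : 𝔼 (n+1)) 1) \ {(v : 𝔼 (n+1))} ⊆ C := by
    rintro y ⟨hy, hyv⟩
    have hy1 : ‖y‖ = 1 := by simpa using hy
    have hle : ⟪(v : 𝔼 (n+1)), y⟫ ≤ 1 := by
      have := real_inner_le_norm (v : 𝔼 (n+1)) y
      rwa [hv, hy1, one_mul] at this
    have hne : ⟪(v : 𝔼 (n+1)), y⟫ ≠ 1 := fun h =>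
      hyv ((inner_eq_one_iff_of_norm_eq_one hv hy1).1 h).symm
    exact lt_of_le_of_ne hle hne
  have himage : stereoToFun (v : 𝔼 (n+1)) '' ((sphere (0 : 𝔼 (n+1)) 1) \ {(v : 𝔼 (n+1))}) =
      univ := by
    refine eq_univ_of_forall fun z => ?_
    refine ⟨((stereographic hv).symm z : 𝕊 n), ⟨((stereographic hv).symm z).2, ?_⟩, ?_⟩
    · intro h
      have h' : (stereographic hv).symm z = ⟨(v : 𝔼 (n+1)), by simp [hv]⟩ :=
        Subtype.ext (by simpa using h)
      have hmem := (stereographic hv).map_target (x := z) (by simp)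
      rw [stereographic_source] at hmem
      exact hmem h'
    · have := (stereographic hv).right_inv (x := z) (by simp)
      exact this
  calc (n : ℝ≥0∞) = finrank ℝ W := by rw [hW]
    _ = dimH (univ : Set W) := (Real.dimH_univ_eq_finrank W).symm
    _ = dimH (stereoToFun (v : 𝔼 (n+1)) '' ((sphere (0 : 𝔼 (n+1)) 1) \ {(v : 𝔼 (n+1))})) := by
        rw [himage]
    _ ≤ dimH ((sphere (0 : 𝔼 (n+1)) 1) \ {(v : 𝔼 (n+1))}) := hσ.dimH_image_le hC hsub

/-- The unit sphere of `ℝⁿ⁺¹` has Hausdorff dimension at most `n`: off one point it is the image of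
the `n`-dimensional space `vᗮ` under the smooth inverse stereographic projection. [folklore] -/
theorem dimH_sphere_le (n : ℕ) : dimH (sphere (0 : 𝔼 (n+1)) 1) ≤ n := by
  haveI := Fact.mk (@finrank_euclideanSpace_fin ℝ _ (n + 1))
  let v : 𝕊 n := spherePt n
  have hv : ‖(v : 𝔼 (n+1))‖ = 1 := norm_eq_of_mem_sphere v
  set W : Submodule ℝ (𝔼 (n+1)) := (ℝ ∙ (v : 𝔼 (n+1)))ᗮ
  have hW : finrank ℝ W = n := Submodule.finrank_orthogonal_span_singleton (ne_zero_of_mem_unit_sphere v)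
  let g : W → 𝔼 (n+1) := fun w => stereoInvFunAux (v : 𝔼 (n+1)) (w : 𝔼 (n+1))
  have hg : ContDiff ℝ 1 g := (contDiff_stereoInvFunAux.comp W.subtypeL.contDiff)
  have hrange : dimH (range g) ≤ n := by
    have := hg.dimH_range_le
    rwa [hW] at this
  have hcover : sphere (0 : 𝔼 (n+1)) 1 ⊆ range g ∪ {(v : 𝔼 (n+1))} := by
    intro y hy
    by_cases hyv : y = v
    · exact Or.inr hyv
    · refine Or.inl ⟨stereographic hv ⟨y, hy⟩, ?_⟩
      have hsrc : (⟨y, hy⟩ : 𝕊 n) ∈ (stereographic hv).source := by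
        rw [stereographic_source]
        exact fun h => hyv (congrArg Subtype.val h)
      have := (stereographic hv).left_inv hsrc
      exact congrArg Subtype.val this
  calc dimH (sphere (0 : 𝔼 (n+1)) 1) ≤ dimH (range g ∪ {(v : 𝔼 (n+1))}) := dimH_mono hcover
    _ = max (dimH (range g)) (dimH ({(v : 𝔼 (n+1))} : Set (𝔼 (n+1)))) := dimH_union _ _
    _ ≤ n := by rw [dimH_singleton]; exact max_le hrange bot_le

variable {k : ℕ}

/-- The image of the sphere `𝕊ᵏ` under a `C¹` map of spheres has Hausdorff dimension at most `k`
(read in the ambient space of the target). [folklore] -/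
theorem dimH_range_coe_comp_le {f : 𝕊 k → 𝕊 n} (hf : ContMDiff (𝓡 k) (𝓡 n) 1 f) :
    dimH (range fun x => (f x : 𝔼 (n+1))) ≤ k := by
  haveI := Fact.mk (@finrank_euclideanSpace_fin ℝ _ (n + 1))
  haveI := Fact.mk (@finrank_euclideanSpace_fin ℝ _ (k + 1))
  -- the radial extension of `ι ∘ f`
  let p : 𝕊 k := spherePt k
  let F : 𝔼 (k+1) → 𝔼 (n+1) := fun y => (f (radialProjection p y) : 𝔼 (n+1))
  have hF : ContMDiffOn 𝓘(ℝ, 𝔼 (k+1)) 𝓘(ℝ, 𝔼 (n+1)) 1 F {y | y ≠ 0} :=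
    (contMDiff_coe_sphere.comp hf).comp_contMDiffOn
      ((contMDiffOn_radialProjection p).of_le (by exact_mod_cast le_top))
  have hF' : ContDiffOn ℝ 1 F {y | y ≠ 0} := contMDiffOn_iff_contDiffOn.1 hF
  -- the range of `ι ∘ f` is the image of the sphere
  have hrange : (range fun x => (f x : 𝔼 (n+1))) = F '' (sphere (0 : 𝔼 (k+1)) 1) := by
    ext z
    constructor
    · rintro ⟨x, rfl⟩
      refine ⟨x, x.2, ?_⟩
      simp only [F]
      rw [radialProjection_coe_sphere p x]
    · rintro ⟨y, hy, rfl⟩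
      exact ⟨radialProjection p y, rfl⟩
  -- cover the sphere by the `2(k+1)` open half-spaces `± yᵢ > 0`, convex and avoiding `0`
  let H : Fin (k+1) × Bool → Set (𝔼 (k+1)) := fun ib =>
    {y | 0 < (if ib.2 then y ib.1 else -y ib.1)}
  have hHconv : ∀ ib, Convex ℝ (H ib) := by
    rintro ⟨i, b⟩
    cases b
    · simpa [H] using convex_halfSpace_gt (-(EuclideanSpace.proj (𝕜 := ℝ) i)).isLinear (0 : ℝ)
    · simpa [H] using convex_halfSpace_gt (EuclideanSpace.proj (𝕜 := ℝ) i).isLinear (0 : ℝ)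
  have hH0 : ∀ ib, H ib ⊆ {y | y ≠ 0} := by
    rintro ⟨i, b⟩ y hy rfl
    cases b <;> simp [H] at hy
  have hcover : sphere (0 : 𝔼 (k+1)) 1 ⊆ ⋃ ib, H ib := by
    intro y hy
    have hy0 : y ≠ 0 := by
      intro h; rw [h] at hy; simp at hy
    obtain ⟨i, hi⟩ : ∃ i, y i ≠ 0 := by
      by_contra! h
      exact hy0 (PiLp.ext h)
    rcases lt_or_gt_of_ne hi with hlt | hgt
    · exact mem_iUnion.2 ⟨(i, false), by simpa [H] using hlt⟩
    · exact mem_iUnion.2 ⟨(i, true), by simpa [H] using hgt⟩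
  have hpiece : ∀ ib, dimH (F '' (sphere (0 : 𝔼 (k+1)) 1 ∩ H ib)) ≤ k := fun ib =>
    calc dimH (F '' (sphere (0 : 𝔼 (k+1)) 1 ∩ H ib)) ≤ dimH (sphere (0 : 𝔼 (k+1)) 1 ∩ H ib) :=
          (hF'.mono (hH0 ib)).dimH_image_le (hHconv ib) inter_subset_right
      _ ≤ dimH (sphere (0 : 𝔼 (k+1)) 1) := dimH_mono inter_subset_left
      _ ≤ k := dimH_sphere_le k
  have himg : F '' (sphere (0 : 𝔼 (k+1)) 1) ⊆ ⋃ ib, F '' (sphere (0 : 𝔼 (k+1)) 1 ∩ H ib) := by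
    rintro _ ⟨y, hy, rfl⟩
    obtain ⟨ib, hib⟩ := mem_iUnion.1 (hcover hy)
    exact mem_iUnion.2 ⟨ib, ⟨y, ⟨hy, hib⟩, rfl⟩⟩
  rw [hrange]
  calc dimH (F '' sphere (0 : 𝔼 (k+1)) 1) ≤ dimH (⋃ ib, F '' (sphere (0 : 𝔼 (k+1)) 1 ∩ H ib)) :=
        dimH_mono himg
    _ = ⨆ ib, dimH (F '' (sphere (0 : 𝔼 (k+1)) 1 ∩ H ib)) := dimH_iUnion _
    _ ≤ k := iSup_le hpiece

/-- **A `C¹` map `𝕊ᵏ → 𝕊ⁿ` with `k < n` is not surjective** (it misses a point; a trivial case of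
Sard's theorem, via Hausdorff dimension: `dim 𝕊ᵏ ≤ k < n ≤ dim (𝕊ⁿ ∖ pt)`); the proved corollary
"`f(M) ≠ N`" of Hirsch's "`f(M)` is nowhere dense". [cite: HirschDT1976, Ch. 3 §1 Prop. 1.2] -/
theorem exists_notMem_range_of_contMDiff (hkn : k < n) {f : 𝕊 k → 𝕊 n}
    (hf : ContMDiff (𝓡 k) (𝓡 n) 1 f) : ∃ q : 𝕊 n, q ∉ range f := by
  by_contra! hsurj
  let v : 𝕊 n := spherePt n
  have h1 : (sphere (0 : 𝔼 (n+1)) 1) \ {(v : 𝔼 (n+1))} ⊆ range fun x => (f x : 𝔼 (n+1)) := by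
    rintro y ⟨hy, -⟩
    obtain ⟨x, hx⟩ := hsurj ⟨y, hy⟩
    exact ⟨x, by simp [hx]⟩
  have := calc (n : ℝ≥0∞) ≤ dimH ((sphere (0 : 𝔼 (n+1)) 1) \ {(v : 𝔼 (n+1))}) :=
          le_dimH_sphere_diff_singleton v
    _ ≤ dimH (range fun x => (f x : 𝔼 (n+1))) := dimH_mono h1
    _ ≤ k := dimH_range_coe_comp_le hf
  exact absurd (by exact_mod_cast this) (not_le.2 hkn)

/-- A smooth embedding of spheres `𝕊ᵏ ↪ 𝕊ⁿ`, `k < n` (in particular a knot or a 2-knot), misses a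
point. [folklore] -/
theorem SphereEmbedding.exists_notMem_range (hkn : k < n) (K : SphereEmbedding k n) :
    ∃ q : 𝕊 n, q ∉ range K :=
  exists_notMem_range_of_contMDiff hkn (K.contMDiff.of_le (by exact_mod_cast le_top))

/-- A 2-knot `S² ↪ S⁴` misses a point of `S⁴`. [folklore] -/
theorem TwoKnot.exists_notMem_range (K : TwoKnot) : ∃ q : 𝕊 4, q ∉ range K :=
  SphereEmbedding.exists_notMem_range (by norm_num) K

/-- **Discharge of the named fact `Literature.Topology.FourManifolds.SphereEmbedding.nonempty_complement`** (`Knots.lean`): in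
positive codimension the complement of a sphere embedding is nonempty.
[cite: HirschDT1976, Ch. 3 §1 Prop. 1.2] -/
theorem SphereEmbedding.nonempty_complement_holds :
    SphereEmbedding.nonempty_complement (k := k) (n := n) := by
  intro K h
  obtain ⟨q, hq⟩ := K.exists_notMem_range h
  exact ⟨⟨q, hq⟩⟩

/-- **A `C¹` map `𝕊ᵏ → 𝕊ⁿ` with `k < n` misses a pair of antipodal points**: some `q` has both `q`
and `-q` off the image (the image together with its antipodal reflection still has Hausdorff
dimension `≤ k < n`). [cite: HirschDT1976, Ch. 3 §1 Prop. 1.2] -/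
theorem exists_notMem_range_neg_notMem_range_of_contMDiff (hkn : k < n) {f : 𝕊 k → 𝕊 n}
    (hf : ContMDiff (𝓡 k) (𝓡 n) 1 f) : ∃ q : 𝕊 n, q ∉ range f ∧ -q ∉ range f := by
  by_contra! hsurj
  let v : 𝕊 n := spherePt n
  set R : Set (𝔼 (n+1)) := range fun x => (f x : 𝔼 (n+1)) with hR
  have h1 : (sphere (0 : 𝔼 (n+1)) 1) \ {(v : 𝔼 (n+1))} ⊆ R ∪ (LinearIsometryEquiv.neg ℝ) '' R := by
    rintro y ⟨hy, -⟩
    by_cases hyR : (⟨y, hy⟩ : 𝕊 n) ∈ range f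
    · obtain ⟨x, hx⟩ := hyR
      exact Or.inl ⟨x, by simp [hx]⟩
    · obtain ⟨x, hx⟩ := hsurj ⟨y, hy⟩ hyR
      refine Or.inr ⟨(f x : 𝔼 (n+1)), ⟨x, rfl⟩, ?_⟩
      have : ((f x : 𝕊 n) : 𝔼 (n+1)) = -y := by rw [hx]; rfl
      simp [LinearIsometryEquiv.coe_neg, this]
  have h2 : dimH ((LinearIsometryEquiv.neg ℝ) '' R) ≤ k := by
    rw [(LinearIsometryEquiv.neg ℝ (E := 𝔼 (n+1))).isometry.dimH_image]
    exact dimH_range_coe_comp_le hf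
  have := calc (n : ℝ≥0∞) ≤ dimH ((sphere (0 : 𝔼 (n+1)) 1) \ {(v : 𝔼 (n+1))}) :=
          le_dimH_sphere_diff_singleton v
    _ ≤ dimH (R ∪ (LinearIsometryEquiv.neg ℝ) '' R) := dimH_mono h1
    _ = max (dimH R) (dimH ((LinearIsometryEquiv.neg ℝ) '' R)) := dimH_union _ _
    _ ≤ k := max_le (dimH_range_coe_comp_le hf) h2
  exact absurd (by exact_mod_cast this) (not_le.2 hkn)

/-- A 2-knot `K : S² ↪ S⁴` misses a pair of antipodal points `±q` of `S⁴` (so that every chord from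
`q` to a point of `K` avoids the origin). [folklore] -/
theorem TwoKnot.exists_notMem_range_neg_notMem_range (K : TwoKnot) :
    ∃ q : 𝕊 4, q ∉ range K ∧ -q ∉ range K :=
  exists_notMem_range_neg_notMem_range_of_contMDiff (by norm_num)
    (K.contMDiff.of_le (by exact_mod_cast le_top))

end DimH

end Literature.Topology.FourManifolds
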